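import Summits.AtomisticToContinuum.Crystallization.Theses.HcpThetaUniversality
import Summits.AtomisticToContinuum.Crystallization.Theorems.ThreeConeCertificateExactCertificateZeroPressure
import Literature.MathematicalPhysics.StatisticalMechanics.LennardJonesClusters

/-!
# Route `HcpThetaUniversality`, item stmt-AtomisticToContinuum-5061 `LjVirialInvSix`

The VIRIAL IDENTITY for finite Lennard-Jones ground states in `ℝ³`
(`V_LJ(r) = r⁻¹²/12 − r⁻⁶/6`, `interactionEnergy V x = Σ_{i<j} V(|xᵢ − xⱼ|)`):
if `x` is a ground state of `N` particles then

  `interactionEnergy lennardJones x = −(1/24) Σ_i Σ_j |xᵢ − xⱼ|⁻⁶`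

(full double sum, the diagonal contributing `0⁻¹ ^ 6 = 0`).

Proof (calculus-free up to Fermat for a two-term curve): with the pair sums
`A = Σ_{i<j} r⁻¹²`, `B = Σ_{i<j} r⁻⁶`, the dilate `t • x` (`t > 0`) is again an injective
configuration and `𝓔(t • x) = (1/12) t⁻¹² A − (1/6) t⁻⁶ B`
(`interactionEnergy_lennardJones_dilate`); minimality of the ground state gives
`𝓔(x) = E(N) ≤ 𝓔(t • x)` for all `t > 0`, so the two-term dilation curve has a minimum at
`t = 1` and `B = A` (`Dilation.eq_of_forall_dilationCurve_le`, the Fermat step already in the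
tree); hence `𝓔(x) = A/12 − B/6 = −B/12 = −(1/24)·(2B)` and `2B = Σ_i Σ_j r⁻⁶`
(`two_mul_interactionEnergy_eq_sum_sum`, as `V(0) = 0`). [folklore; BlancLewin2015 §2.5]
-/

noncomputable section

namespace Summit.AtomisticToContinuum.Crystallization.Theorems

open Literature.MathematicalPhysics.StatisticalMechanics
open scoped BigOperators

/-- **Dilation curve of the finite Lennard-Jones energy.** For `t > 0` and any finite
configuration `x` of `ℝ³`, the energy of the dilate `t • x` is the explicit two-term function
`𝓔_LJ(t • x) = (1/12) t⁻¹² Σ_{i<j} |xᵢ − xⱼ|⁻¹² − (1/6) t⁻⁶ Σ_{i<j} |xᵢ − xⱼ|⁻⁶`. [folklore] -/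
theorem interactionEnergy_lennardJones_dilate {N : ℕ} (x : Fin N → EuclideanSpace ℝ (Fin 3))
    {t : ℝ} (ht : 0 < t) :
    interactionEnergy lennardJones (fun i => t • x i) =
      (1 / 12) * (t⁻¹) ^ 12 * ∑ i, ∑ j ∈ Finset.Ioi i, ((dist (x i) (x j))⁻¹) ^ 12 -
        (1 / 6) * (t⁻¹) ^ 6 * ∑ i, ∑ j ∈ Finset.Ioi i, ((dist (x i) (x j))⁻¹) ^ 6 := by
  have hLJ : ∀ r : ℝ, lennardJones (t * r) =
      (1 / 12) * (t⁻¹) ^ 12 * (r⁻¹) ^ 12 - (1 / 6) * (t⁻¹) ^ 6 * (r⁻¹) ^ 6 := by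
    intro r
    simp only [lennardJones, mul_inv, mul_pow]
    ring
  unfold interactionEnergy
  simp only [dist_smul₀, Real.norm_eq_abs, abs_of_pos ht, hLJ, Finset.sum_sub_distrib,
    ← Finset.mul_sum]

/-- **Item stmt-AtomisticToContinuum-5061** (`LjVirialInvSix`, support of route
`HcpThetaUniversality`): the virial identity `𝓔_LJ(x) = −(1/24) Σ_i Σ_j |xᵢ − xⱼ|⁻⁶` for every
finite Lennard-Jones ground state `x` in `ℝ³` (minimality against the dilates `t • x` forces
`Σ_{i<j} r⁻¹² = Σ_{i<j} r⁻⁶`). [folklore; BlancLewin2015 §2.5] -/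
theorem ljVirialInvSix_proof :
    Summit.AtomisticToContinuum.Crystallization.Theses.HcpThetaUniversality.LjVirialInvSix := by
  unfold Summit.AtomisticToContinuum.Crystallization.Theses.HcpThetaUniversality.LjVirialInvSix
  intro N x hx
  obtain ⟨hinj, hE⟩ := hx
  set A : ℝ := ∑ i, ∑ j ∈ Finset.Ioi i, ((dist (x i) (x j))⁻¹) ^ 12 with hA
  set B : ℝ := ∑ i, ∑ j ∈ Finset.Ioi i, ((dist (x i) (x j))⁻¹) ^ 6 with hB
  -- the energy itself is the dilation curve at `t = 1`
  have h1 : interactionEnergy lennardJones x = (1 / 12) * A - (1 / 6) * B := by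
    have h := interactionEnergy_lennardJones_dilate x one_pos
    simp only [one_smul, inv_one, one_pow, mul_one] at h
    exact h
  -- minimality of the ground state against its (injective) dilates
  have hmin : ∀ t : ℝ, 0 < t →
      (1 / 12) * A - (1 / 6) * B ≤ (1 / 12) * (t⁻¹) ^ 12 * A - (1 / 6) * (t⁻¹) ^ 6 * B := by
    intro t ht
    have hinj' : Function.Injective (fun i => t • x i) := fun i j hij =>
      hinj (smul_right_injective (EuclideanSpace ℝ (Fin 3)) ht.ne' hij)
    rw [← interactionEnergy_lennardJones_dilate x ht, ← h1, hE]
    exact groundStateEnergy_lennardJones_le hinj'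
  -- Fermat at `t = 1` for the two-term curve: `B = A`
  have hBA : B = A :=
    ThreeConeCertificateExactCertificate.Dilation.eq_of_forall_dilationCurve_le
      (fun t => (1 / 12) * (t⁻¹) ^ 12 * A - (1 / 6) * (t⁻¹) ^ 6 * B) (fun _ => rfl)
      (fun t ht => by
        simp only [inv_one, one_pow, mul_one]
        exact hmin t ht)
  -- the full double sum of `r⁻⁶` is twice the pair sum (`0⁻¹ ^ 6 = 0` on the diagonal)
  have h2 : ∑ i, ∑ j, ((dist (x i) (x j))⁻¹) ^ 6 = 2 * B := by
    have h := two_mul_interactionEnergy_eq_sum_sum (fun r : ℝ => (r⁻¹) ^ 6) (by norm_num) x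
    simp only [interactionEnergy] at h
    rw [hB]
    exact h.symm
  rw [h1, h2, hBA]
  ring

end Summit.AtomisticToContinuum.Crystallization.Theorems

end
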